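import Literature.MathematicalPhysics.QuantumFieldTheory.Balaban1983to89.B9Thm311KernelDecayTouchingCubeZd
import Literature.MathematicalPhysics.QuantumFieldTheory.Balaban1983to89.B9Eq342GreenHermOperatorDecayZd

/-!
# `Balaban1983to89.B9Eq342GreenHermOperatorDecayCubeZd` — [Balaban1985BackgroundPropagators] Thm 3.3 p. 399 with (3.42) p. 397 (the `n = 0` member
# «|(G(U)λ)(x)| ≤ B₀ Σ e^{−δ₀|x−x′|}…») and Thm 3.11 p. 416, FOR THE GENUINE `G_𝔤(U₀) = (□₀Δ_a(U₀)□₀)⁻¹` AT ONE CUBE MEMBER, DATUM-KEYED: from the KERNEL bound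
# `|(G_𝔤(U₀)δ_{b′}w)(b)|_τ ≤ C·e^{−κ|b−b′|_∞}·|w|_τ` (this seat's `B9Thm311KernelDecayTouchingCubeZd`, dag-n06-w2's Combes–Thomas road) to the OPERATOR bound
# `|(G_𝔤(U₀)J)(b)|_τ ≤ C·Σ_{b′} e^{−κ|b−b′|_∞}·|J(b′)|_τ` for every Hermitian `J ∈ E_𝔤(□₀)`, and its sup form `≤ C·d·K_d(κ)·sup|J|_τ` — at every unitary `U₀` whose
# plaquettes touching `□₀` are `α`-small, in particular every datum `U₀ ∈ 𝔄_m({□_j}, α₀)`, `α₀ ≤ α` (NO displayed hypothesis; constants per member)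

statement-level skeleton of published theorems with citation tags; proofs where landed; nothing here is a claim about the
Yang–Mills mass gap

`[Balaban1985BackgroundPropagators]` ("B9", CMP **99** (1985) 389–434): (3.42) p. 397 (the form of the estimates of Thm 3.1: kernel-type bounds `B₀ e^{−δ₀ dist}`
applied to the input), Thm 3.3 p. 399 («the inequalities (3.42)–(3.47) hold for … G′(U) replaced by G(U)»), (3.27) p. 395, Thm 3.11 p. 416; [Balaban1985RegularSpaces]
(1.7) p. 77, (1.58)–(1.59) p. 86 (how [B8] reads Thm 3.3: bounds of `G(U₀)J` for `J` supported on the bonds of `Ω₀`), (1.131) p. 99.  HERE: bookkeeping — a bond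
field on `E(Ω₀)` is the finite sum of its single-bond bumps, `G_𝔤` is additive, the fibre size is subadditive; the row sum of `e^{−κ|·|_∞}` over the bonds touching
a finite `Ω₀` is at most `d·K_d(κ)` (dag-n06-w2's `sum_exp_neg_mul_linfDist_le`).

CITATION HEADER (lean-in-tree rule).  Cell `pub-ymgap` (YM Track A, HUMAN RULING D-0062 ∕ D-0149), DAG node N06 = [B9], seat `pub-ymgap-dag-n06-b` (g21; junction ∕
letter lineage), CLAIM-3 part (b).  Inputs BY NAME: this seat's `B9Thm311KernelDecayTouchingCubeZd.{exists_kernelDecay_of_plaqTouches_cube, exists_kernelDecay_of_inAk_cube}`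
and `B9Eq342GreenHermOperatorDecayZd.{fnorm_gopZdH_apply_le_sum_of_kernelDecay, fnorm_gopZdH_apply_le_sup_of_kernelDecay}` (part (a)); dag-n06-w4's
`B9Eq327GreenZd.setOf_bondTouches_finite`, this seat's `B9Eq327GreenZdHerm.{domSubH, gopZdH}`; dag-n06-w2's `B9Eq342CombesThomasFormZd.fnorm`;
dag-n06-w4's `B9Thm311PosDefOpenZd.cubeMember_Ω0_finite`.  Nothing restated.

WHAT IS PROVED (kernel, 0 sorry, 0 def; the record-free step «kernel ⟹ operator» is the companion `B9Eq342GreenHermOperatorDecayZd`, cited by name).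
* (the cube member, no displayed hypothesis): ★★★ `exists_operatorDecay_of_plaqTouches_cube`, ★★★ `exists_operatorDecay_of_inAk_cube` (∃ α C κ > 0: the operator bound
  with decay for every unitary `U₀` with touching plaquettes `α`-small ∕ every `U₀ ∈ 𝔄_m({□_j}, α₀)`, `α₀ ≤ α`), ★★★ `exists_operatorSup_of_inAk_cube` (∃ α B > 0: the sup
  bound `|(G_𝔤(U₀)J)(b)|_τ ≤ B·sup|J|_τ` for every datum — the `n = 0` entry of [B8] (1.59)'s reading of Thm 3.3, in the fibre size, datum-keyed).

HONEST SCOPE.  Count-neutral helper; `α, C, κ, B` EXISTENTIAL and MEMBER-DEPENDENT (compactness + crude letter sizes; through `η = i.η`, `m`, the cube data) — print's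
Theorem 3.3 is UNIFORM with `δ₀, B₀` depending on `d, L` only: NOT proved; entries `n = 1, 2, 3` of (3.42) (`∇G`, `G∇*`, `ΔG`), the Hölder and `L^p` members
(3.43)–(3.46) and the weighted form (3.47) are NOT here; the fibre size `|·|_τ` is used, not the operator norm (comparable on a finite-dimensional fibre,
`B9Eq326LocalLettersBumpBoundsZd.exists_fnorm_cmp`); N05 ∕ N06 NOT discharged; K1⁹ `stmt-QuantumFields-27364` NOT closed; one finite `𝕋⁴` programme at fixed `ε`,
Bałaban as printed; R4 closes only the conditional finite-`𝕋⁴` rung `BalabanLadder.UV` — nothing continuum ∕ ℝ⁴ ∕ OS ∕ mass gap ∕ Clay.  Unit `pub-ymgap-dag-n06-b`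
(g21), 2026-08-28.
-/

noncomputable section

open scoped BigOperators Nat

namespace Literature.MathematicalPhysics.QuantumFieldTheory.Balaban1983to89.B9Eq342GreenHermOperatorDecayCubeZd

open B7Prop2Explicit (unitaryUnits)
open B7Prop5Flat (bump)
open B8Ineq132 (PlaqTouches BondTouches plaqF InAk)
open B8Eq131CubesAdmissible (cubeFam)
open B8CubeMemberZd (cubeLamS)
open B8Ineq159FlatCubeMemberPrinted (cubeLamBP)
open B8LeafModelZd (ZdIdx)
open B9SupplySockB9P3ZdLetters (OpsZd)
open B9Eq327GreenZd (setOf_bondTouches_finite)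
open B9Eq327GreenZdHerm (domSubH gopZdH)
open B9SupplySockB9P3ZdAllLettersZd (opsAllZd)
open B9Eq342CombesThomasFormZd (fnorm)
open B9Eq342GreenHermOperatorDecayZd (fnorm_gopZdH_apply_le_sum_of_kernelDecay fnorm_gopZdH_apply_le_sup_of_kernelDecay)
open B9Thm311KernelDecayTouchingCubeZd (exists_kernelDecay_of_plaqTouches_cube exists_kernelDecay_of_inAk_cube)
open LatticeNorms (linfDist)

-- `Site` alone could resolve to the torus sites of `Setup.lean`; re-export the `ℤ^d` sites of `B7Prop1Explicit`.
export B7Prop1Explicit (Site)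

variable {d : ℕ} {𝔸 : Type*} [CStarAlgebra 𝔸]

/-! ## The cube member: the operator bound for every datum, no displayed hypothesis -/

section Cube

variable (τ : 𝔸 →ₗ[ℂ] ℂ) [FiniteDimensional ℝ 𝔸] [Nontrivial 𝔸] {L : ℕ}

/-- ★★★ **THE `n = 0` MEMBER OF (3.42) FOR THE GENUINE `G_𝔤` AT A CUBE MEMBER, FROM THE TOUCHING PLAQUETTES** (`Ω = cubeFam false L a₀ Mc ρ k`, `Λs = cubeLamS …`, class
`cubeLamBP`, `m ≤ k`, `2 ≤ d`, `2 ≤ L ≤ ρ`, weights `a ≥ 0`, faithful Hermitian tracial `τ` on a finite-dimensional fibre): `∃ α C κ > 0` such that EVERY unitary `U₀` whose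
plaquettes touching `□₀` are `α`-close to `1` satisfies, for every `J ∈ E_𝔤(□₀)` and bond `b` touching `□₀`,
`|(G_𝔤(U₀)J)(b)|_τ ≤ Σ_{b′ touching □₀} C·e^{−κ|b−b′|_∞}·|J(b′)|_τ`.
[cite: Balaban1985BackgroundPropagators, Thm 3.3 p.399, (3.42) p.397, Thm 3.11 p.416, (3.27) p.395; Balaban1985RegularSpaces, (1.7) p.77, (1.131) p.99] -/
theorem exists_operatorDecay_of_plaqTouches_cube (hτp : ∀ a : 𝔸, a ≠ 0 → 0 < (τ (star a * a)).re) (hτt : ∀ a b : 𝔸, τ (a * b) = τ (b * a))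
    (hτs : ∀ a : 𝔸, τ (star a) = starRingEnd ℂ (τ a)) (hd2 : 2 ≤ d) (hL : 2 ≤ L) (ops₀ : ℝ → ZdIdx d L → ℕ → OpsZd d 𝔸) (M : ℝ) (i : ZdIdx d L)
    {a₀ : Site d} {Mc ρ : ℕ} (hρ : L ≤ ρ) (hΩ : i.Ω = cubeFam false L a₀ Mc ρ i.k) (hΛs : i.Λs = cubeLamS L a₀ Mc ρ i.k) {m : ℕ} (hm : m ≤ i.k)
    (a : ℕ → ℝ) (ha : ∀ j, 0 ≤ a j) :
    ∃ α : ℝ, 0 < α ∧ ∃ C : ℝ, 0 < C ∧ ∃ κ : ℝ, 0 < κ ∧ ∀ U₀ : Site d → Fin d → 𝔸ˣ, (∀ x κ', U₀ x κ' ∈ unitaryUnits 𝔸) →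
      (∀ (z : Site d) (κ' μ : Fin d), κ' ≠ μ → PlaqTouches (i.Ω 0) z κ' μ → ‖plaqF U₀ κ' μ z - 1‖ ≤ α) →
        ∀ J ∈ domSubH (𝔸 := 𝔸) (i.Ω 0), ∀ b : Site d × Fin d, BondTouches (i.Ω 0) b.1 b.2 →
          fnorm τ (gopZdH i.η (opsAllZd τ L (cubeLamBP L a₀ Mc ρ i.k) ops₀ M i m) (i.Ω 0) U₀ J b.1 b.2) ≤
            ∑ b' ∈ (setOf_bondTouches_finite (B9Thm311PosDefOpenZd.cubeMember_Ω0_finite i hΩ)).toFinset,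
              C * Real.exp (-(κ * (linfDist b.1 b'.1 : ℝ))) * fnorm τ (J b'.1 b'.2) := by
  obtain ⟨α, hα, C, hC, κ, hκ, h⟩ := exists_kernelDecay_of_plaqTouches_cube τ hτp hτt hτs hd2 hL ops₀ M i hρ hΩ hΛs hm a ha
  exact ⟨α, hα, C, hC, κ, hκ, fun U₀ hU₀ hsmall J hJ b hb =>
    fnorm_gopZdH_apply_le_sum_of_kernelDecay τ hτp hτs i.η _ (B9Thm311PosDefOpenZd.cubeMember_Ω0_finite i hΩ) U₀ (h U₀ hU₀ hsmall) hJ b hb⟩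

/-- ★★★ **THE SAME FOR EVERY DATUM `U₀ ∈ 𝔄_m({□_j}, α₀)`, `α₀ ≤ α`** ([Balaban1985RegularSpaces] (1.33): the socket's own hypothesis).
[cite: Balaban1985BackgroundPropagators, Thm 3.3 p.399, (3.42) p.397, Thm 3.11 p.416; Balaban1985RegularSpaces, (1.7) p.77, (1.33) p.82, (1.58)–(1.59) p.86, (1.131) p.99] -/
theorem exists_operatorDecay_of_inAk_cube (hτp : ∀ a : 𝔸, a ≠ 0 → 0 < (τ (star a * a)).re) (hτt : ∀ a b : 𝔸, τ (a * b) = τ (b * a))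
    (hτs : ∀ a : 𝔸, τ (star a) = starRingEnd ℂ (τ a)) (hd2 : 2 ≤ d) (hL : 2 ≤ L) (ops₀ : ℝ → ZdIdx d L → ℕ → OpsZd d 𝔸) (M : ℝ) (i : ZdIdx d L)
    {a₀ : Site d} {Mc ρ : ℕ} (hρ : L ≤ ρ) (hΩ : i.Ω = cubeFam false L a₀ Mc ρ i.k) (hΛs : i.Λs = cubeLamS L a₀ Mc ρ i.k) {m : ℕ} (hm : m ≤ i.k)
    (a : ℕ → ℝ) (ha : ∀ j, 0 ≤ a j) :
    ∃ α : ℝ, 0 < α ∧ ∃ C : ℝ, 0 < C ∧ ∃ κ : ℝ, 0 < κ ∧ ∀ α₀ : ℝ, α₀ ≤ α → ∀ U₀ : Site d → Fin d → 𝔸ˣ, (∀ x κ', U₀ x κ' ∈ unitaryUnits 𝔸) →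
      InAk L m i.η α₀ i.Ω U₀ →
        ∀ J ∈ domSubH (𝔸 := 𝔸) (i.Ω 0), ∀ b : Site d × Fin d, BondTouches (i.Ω 0) b.1 b.2 →
          fnorm τ (gopZdH i.η (opsAllZd τ L (cubeLamBP L a₀ Mc ρ i.k) ops₀ M i m) (i.Ω 0) U₀ J b.1 b.2) ≤
            ∑ b' ∈ (setOf_bondTouches_finite (B9Thm311PosDefOpenZd.cubeMember_Ω0_finite i hΩ)).toFinset,
              C * Real.exp (-(κ * (linfDist b.1 b'.1 : ℝ))) * fnorm τ (J b'.1 b'.2) := by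
  obtain ⟨α, hα, C, hC, κ, hκ, h⟩ := exists_kernelDecay_of_inAk_cube τ hτp hτt hτs hd2 hL ops₀ M i hρ hΩ hΛs hm a ha
  exact ⟨α, hα, C, hC, κ, hκ, fun α₀ hα₀ U₀ hU₀ hA J hJ b hb =>
    fnorm_gopZdH_apply_le_sum_of_kernelDecay τ hτp hτs i.η _ (B9Thm311PosDefOpenZd.cubeMember_Ω0_finite i hΩ) U₀ (h α₀ hα₀ U₀ hU₀ hA) hJ b hb⟩

/-- ★★★ **THE SUP-NORM READING, FOR EVERY DATUM**: `∃ α B > 0` such that for every `α₀ ≤ α`, every unitary `U₀ ∈ 𝔄_m({□_j}, α₀)`, every `J ∈ E_𝔤(□₀)` with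
`|J(b′)|_τ ≤ S` on the bonds of `□₀` (`S ≥ 0`) and every bond `b` touching `□₀`: `|(G_𝔤(U₀)J)(b)|_τ ≤ B·S` — the `n = 0` entry of [B8] (1.59)'s reading of [B9] Thm 3.3 for
the genuine `G_𝔤`, datum-keyed, in the fibre size (`B = C·d·K_d(κ)`). [cite: Balaban1985BackgroundPropagators, Thm 3.3 p.399, (3.42) p.397; Balaban1985RegularSpaces, (1.58)–(1.59) p.86, (1.7) p.77, (1.131) p.99] -/
theorem exists_operatorSup_of_inAk_cube (hτp : ∀ a : 𝔸, a ≠ 0 → 0 < (τ (star a * a)).re) (hτt : ∀ a b : 𝔸, τ (a * b) = τ (b * a))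
    (hτs : ∀ a : 𝔸, τ (star a) = starRingEnd ℂ (τ a)) (hd2 : 2 ≤ d) (hL : 2 ≤ L) (ops₀ : ℝ → ZdIdx d L → ℕ → OpsZd d 𝔸) (M : ℝ) (i : ZdIdx d L)
    {a₀ : Site d} {Mc ρ : ℕ} (hρ : L ≤ ρ) (hΩ : i.Ω = cubeFam false L a₀ Mc ρ i.k) (hΛs : i.Λs = cubeLamS L a₀ Mc ρ i.k) {m : ℕ} (hm : m ≤ i.k)
    (a : ℕ → ℝ) (ha : ∀ j, 0 ≤ a j) :
    ∃ α : ℝ, 0 < α ∧ ∃ B : ℝ, 0 < B ∧ ∀ α₀ : ℝ, α₀ ≤ α → ∀ U₀ : Site d → Fin d → 𝔸ˣ, (∀ x κ', U₀ x κ' ∈ unitaryUnits 𝔸) →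
      InAk L m i.η α₀ i.Ω U₀ →
        ∀ J ∈ domSubH (𝔸 := 𝔸) (i.Ω 0), ∀ S : ℝ, 0 ≤ S → (∀ b' : Site d × Fin d, BondTouches (i.Ω 0) b'.1 b'.2 → fnorm τ (J b'.1 b'.2) ≤ S) →
          ∀ b : Site d × Fin d, BondTouches (i.Ω 0) b.1 b.2 →
            fnorm τ (gopZdH i.η (opsAllZd τ L (cubeLamBP L a₀ Mc ρ i.k) ops₀ M i m) (i.Ω 0) U₀ J b.1 b.2) ≤ B * S := by
  obtain ⟨α, hα, C, hC, κ, hκ, h⟩ := exists_kernelDecay_of_inAk_cube τ hτp hτt hτs hd2 hL ops₀ M i hρ hΩ hΛs hm a ha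
  have hfin : (i.Ω 0).Finite := B9Thm311PosDefOpenZd.cubeMember_Ω0_finite i hΩ
  have hKd : 0 < (d * ((3 : ℝ) ^ d * (d ! : ℝ) * (2 / κ) ^ d * Real.exp (κ / 2) / (1 - Real.exp (-(κ / 2))))) := by
    have hd0 : (0 : ℝ) < d := by exact_mod_cast (lt_of_lt_of_le zero_lt_two hd2)
    have hden : 0 < 1 - Real.exp (-(κ / 2)) := by
      have : Real.exp (-(κ / 2)) < 1 := Real.exp_lt_one_iff.mpr (by linarith)
      linarith
    positivity
  refine ⟨α, hα, C * (d * ((3 : ℝ) ^ d * (d ! : ℝ) * (2 / κ) ^ d * Real.exp (κ / 2) / (1 - Real.exp (-(κ / 2))))), mul_pos hC hKd,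
    fun α₀ hα₀ U₀ hU₀ hA J hJ S hS0 hS b hb => ?_⟩
  exact fnorm_gopZdH_apply_le_sup_of_kernelDecay τ hτp hτs i.η _ hfin U₀ hC.le hκ (h α₀ hα₀ U₀ hU₀ hA) hJ hS0 hS b hb

end Cube

end Literature.MathematicalPhysics.QuantumFieldTheory.Balaban1983to89.B9Eq342GreenHermOperatorDecayCubeZd

end
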